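/-
Copyright (c) 2026 the pub-hodgecm-mathlib formalisation cell (harness21).  Prover seat hodgecm-mathlib-K2-defs1 (g6), Track B, h413 = `stmt-HodgeConjecture-24833`, route `HCCMUnconditional`,
deal (261) of dealer K2E1-plan (g7) 2026-09-04T13:48:23Z: GENERIC-EIGENVALUE EDITION 1 — the (χ,τ) uniqueness head `hunq` (★ K2E1-p15 `K2E1ChiUniquenessHunqCMTwo`) with `ŝ_i(z)` for `∫ h_i·H^z`.
-/
import Summits.HodgeConjecture.HodgeConjecture.Theorems.K2E1ChiUniquenessHunqCMTwo          -- ★ (K2E1-p15): the ĥ-currency heads; brings ★ P6′ bricks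
import Summits.HodgeConjecture.HodgeConjecture.Theorems.K2E1ChiHomogeneousL2U2Eigen        -- 📤 (this seat): `hL2_chi_cm_two_of_eigen`
import Summits.HodgeConjecture.HodgeConjecture.Theorems.K2E1ChiHeckeMatrixSeparationU2    -- ★ 12c (this seat): `exists_isOpen_forall_not_hasEigenvalue_of_eq_smul` (non-constant entire ⇒ `Im ≠ 0` somewhere)
import HarnessLib

/-!
# `K2E1ChiUniquenessHunqCMTwoEigen` — GENERIC-EIGENVALUE EDITION of ★ `K2E1ChiUniquenessHunqCMTwo` (K2E1-p15): the (χ,τ) UNIQUENESS HEAD with the spherical transforms `∫ h_i·H^z dν_G`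
# replaced by eigenvalue functions `ŝ_i(z)`; the non-emptiness of `{Im ŝ_{i₀} ≠ 0}` on the Godement part of the ball now comes from `ŝ_{i₀}` ENTIRE and NON-CONSTANT (★ 12c §1) instead of
# ★ `uniqueSetSA_nonempty_two` (`Re h ≥ 0`, `h(1) ≠ 0`)

Cell `pub/hodgecm-mathlib`, crux H413 = `stmt-HodgeConjecture-24833`.  THEOREMS ONLY (no `def`, no `instance`, no notation, no named-fact hypothesis, no `sorry`); lane `--supports
stmt-HodgeConjecture-24833 --as helper` (count-neutral).  Closes no socket.  THIS FILE = ★'s three heads VERBATIM with `(∫ x, h i x * ↑↑(borelHeight x) ^ z ∂νG) ↦ ŝ i z`; §1's proof used the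
transform only as a scalar with `Im ≠ 0` (self-adjoint `R(h_{i₀})` has no non-real eigenvalue) plus its continuity (now `hŝc`); §2's letters `h0 hh1` become `hŝd : Differentiable ℂ (ŝ i₀)`,
`hnc : ∃ z₁ z₂, ŝ i₀ z₁ ≠ ŝ i₀ z₂` — exactly ★ convData_χ's clauses (★ `exists_chi_convData_level_cm_two`); §3 uses 📤 `hL2_chi_cm_two_of_eigen`.
* §1 **`hunq_of_memLp_of_lt_finDim_of_eigen`**, §2 **`hunq_of_memLp_two_finDim_of_eigen`**, §3 **`hunq_chi_cm_two_of_eigen`** (CM, `N = 2`).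
HONEST LABEL: HC_CM is proved only modulo the 7 printed citations (2 remaining named inputs: hLiu418 = `stmt-HodgeConjecture-24832`, h413 = `stmt-HodgeConjecture-24833`) until rung 0
closes; count-neutral helper, closes no socket.

## References
* [BernsteinLapid2019] J. Bernstein, E. Lapid, *On the meromorphic continuation of Eisenstein series*, J. AMS 37 (2024), Thm 2.3, §4 Claim 2 (p. 9).
* [MoeglinWaldspurger1995] C. Mœglin, J.-L. Waldspurger, *Spectral Decomposition and Eisenstein Series* (1995), IV.1.9.
-/

set_option autoImplicit false
set_option linter.dupNamespace false  -- the mandated namespace repeats the summit's segment (`HodgeConjecture.HodgeConjecture`)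

noncomputable section

open MeasureTheory Measure Set NumberField IsDedekindDomain Filter Topology Metric CompactlySupported
open scoped NNReal ENNReal InnerProductSpace ComplexConjugate
open Literature.MeasureTheory.Group Literature.NumberTheory.Automorphic Literature.NumberTheory.Automorphic.UnitaryGroup AdelicGroupData
open Summit.HodgeConjecture.HodgeConjecture.Cruxes.H413.K2E1BLBorelSpacesU2Defs
open Summit.HodgeConjecture.HodgeConjecture.Cruxes.H413.K2E1BLBorelOperatorsU2Defs
open Summit.HodgeConjecture.HodgeConjecture.Cruxes.H413.K2E1SphericalHeckeEigenSectionU2 (differentiable_integral_mul_borelHeight_cpow)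
open Summit.HodgeConjecture.HodgeConjecture.Cruxes.H413.K2E1BLUniquenessSelfAdjointU2 (uniqueSetSA_nonempty_two exists_memLp_toLp_eq_integratedOperator_of_ae_eq absolutelyContinuous_withDensity_weightX eq_zero_of_integratedOperator_rightRegular_eq_smul)
open Summit.HodgeConjecture.HodgeConjecture.Cruxes.H413.K2E1ChiHomogeneousL2U2Eigen (hL2_chi_cm_two_of_eigen)
open Summit.HodgeConjecture.HodgeConjecture.Cruxes.H413

namespace Summit.HodgeConjecture.HodgeConjecture.Cruxes.H413.K2E1ChiUniquenessHunqCMTwoEigen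

/-! ## §1 The rank-generic head on the letters `hne`, `hT`, `hL2` -/

section Generic

variable {F E : Type} [Field F] [NumberField F] [Field E] [NumberField E] [Algebra F E] {c : E ≃ₐ[F] E} {N : ℕ} [NeZero N]
  [MeasurableSpace (quasiSplit F E c N).Adelic] [BorelSpace (quasiSplit F E c N).Adelic]
  (μ : Measure (quasiSplit F E c N).automorphicQuotient) [(quasiSplit F E c N).IsAutomorphicMeasure μ]
  (νG : Measure (quasiSplit F E c N).Adelic) [νG.IsHaarMeasure] [νG.IsInvInvariant] (k : ℕ)

/-- **THE `(χ, τ)` UNIQUENESS HEAD, «L² + SELF-ADJOINT», THRESHOLD-PARAMETRIC AND RANK-GENERIC** — ★ P6′ `hunq_of_memLp_of_lt` with the scalar second constant-term vector replaced by a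
finite-dimensional family: `L : ℂ → B →L V`, `bX : ℂ → B`, constant-term condition `P(ιψ) = φ₀•α₁ z + L z b`.  Data: `X = 𝓗_k(𝔛)` for an automorphic `μ`; an inversion-invariant Haar
measure `νG`; test functions `h i` continuous of compact support with `h i₀` SYMMETRIC and REAL and `Im ĥ_{i₀} ≠ 0` somewhere on `ball 0 (n+2) ∩ {σ₀ < Re}` (letter `hne`); Hecke operators
`T i : X →L X` with `T i₀` of P3-C's shape (letter `hT`); abstract `ι P α₁ L Q φ₀`; the GIVEN solution `(eX, bX)` (`hsolT hsolC hsolQ`); the `L²`-LETTER `hL2` (a homogeneous solution —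
`T i ψ = ĥ_i(z)ψ`, `P(ιψ) = L z b′`, `Q ψ = 0` — at a point of `U₀` is in `L²(μ)`).  THEN every solution `(ψ, b)` at `z ∈ U₀ := ball ∩ {σ₀ < Re} ∩ {Im ĥ_{i₀} ≠ 0}` has `ψ = eX z`.
[cite: BernsteinLapid2019, §4 Claim 2 (p. 9), Thm 2.3] [cite: MoeglinWaldspurger1995, IV.1.9] -/
theorem hunq_of_memLp_of_lt_finDim_of_eigen (σ₀ : ℝ) (n : ℕ) {I : Type*} (i₀ : I) {h : I → (quasiSplit F E c N).Adelic → ℂ}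
    (hhc : ∀ i, Continuous (h i)) (hhs : ∀ i, HasCompactSupport (h i)) (hsymm : ∀ g, h i₀ g⁻¹ = h i₀ g) (hreal : ∀ g, conj (h i₀ g) = h i₀ g)
    (ŝ : I → ℂ → ℂ) (hŝc : Continuous (ŝ i₀))
    (hne : (ball (0 : ℂ) (n + 2) ∩ {z : ℂ | σ₀ < z.re} ∩ {z : ℂ | (ŝ i₀ z).im ≠ 0}).Nonempty)
    (T : I → HX F E c N k μ →L[ℂ] HX F E c N k μ)
    (hT : ∀ u : HX F E c N k μ, ((T i₀ u : HX F E c N k μ) : (quasiSplit F E c N).automorphicQuotient → ℂ) =ᵐ[μ.withDensity fun x => (((supHeight F E c N x)⁻¹ ^ (2 * k) : ℝ≥0) : ℝ≥0∞)]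
      fun ξ => ∫ y, h i₀ y * (u : (quasiSplit F E c N).automorphicQuotient → ℂ) (y⁻¹ • ξ) ∂νG)
    {V : Type*} [NormedAddCommGroup V] [NormedSpace ℂ V] (ι : HX F E c N k μ →L[ℂ] V) (P : V →L[ℂ] V) (α₁ : ℂ → V)
    {B : Type*} [NormedAddCommGroup B] [NormedSpace ℂ B] (L : ℂ → B →L[ℂ] V)
    {X' : Type*} [NormedAddCommGroup X'] [NormedSpace ℂ X'] (Q : HX F E c N k μ →L[ℂ] X') (φ₀ : ℂ) (eX : ℂ → HX F E c N k μ) (bX : ℂ → B)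
    (hsolT : ∀ z ∈ ball (0 : ℂ) (n + 2), σ₀ < z.re → ∀ i, T i (eX z) = (ŝ i z) • eX z)
    (hsolC : ∀ z ∈ ball (0 : ℂ) (n + 2), σ₀ < z.re → P (ι (eX z)) = φ₀ • α₁ z + L z (bX z))
    (hsolQ : ∀ z ∈ ball (0 : ℂ) (n + 2), σ₀ < z.re → Q (eX z) = 0)
    (hL2 : ∀ z ∈ ball (0 : ℂ) (n + 2), σ₀ < z.re → (ŝ i₀ z).im ≠ 0 →
      ∀ (ψ : HX F E c N k μ) (b' : B), (∀ i, T i ψ = (ŝ i z) • ψ) → P (ι ψ) = L z b' → Q ψ = 0 →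
        MemLp (ψ : (quasiSplit F E c N).automorphicQuotient → ℂ) 2 μ) :
    ∃ U₀ : Set ℂ, IsOpen U₀ ∧ U₀.Nonempty ∧ U₀ ⊆ ball (0 : ℂ) (n + 2) ∩ {z : ℂ | σ₀ < z.re} ∧
      ∀ z ∈ U₀, ∀ (ψ : HX F E c N k μ) (b : B), (∀ i, T i ψ = (ŝ i z) • ψ) →
        P (ι ψ) = φ₀ • α₁ z + L z b → Q ψ = 0 → ψ = eX z := by
  refine ⟨ball (0 : ℂ) (n + 2) ∩ {z : ℂ | σ₀ < z.re} ∩ {z : ℂ | (ŝ i₀ z).im ≠ 0}, ?_, hne, inter_subset_left, ?_⟩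
  · exact (isOpen_ball.inter (isOpen_lt continuous_const Complex.continuous_re)).inter
      (isOpen_ne_fun (Complex.continuous_im.comp hŝc) continuous_const)
  rintro z ⟨⟨hzb, hzσ⟩, hzim⟩ ψ b hTψ hPψ hQψ
  -- the difference `ψ - eX z` is a HOMOGENEOUS solution with constant term `L z (b - bX z)`
  have hT' : ∀ i, T i (ψ - eX z) = (ŝ i z) • (ψ - eX z) := fun i => by
    rw [map_sub, hTψ i, hsolT z hzb hzσ i, smul_sub]
  have hP' : P (ι (ψ - eX z)) = L z (b - bX z) := by
    rw [map_sub, map_sub, hPψ, hsolC z hzb hzσ, map_sub]; abel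
  have hQ' : Q (ψ - eX z) = 0 := by rw [map_sub, hQψ, hsolQ z hzb hzσ, sub_zero]
  -- hence in `L²(μ)` (the letter), where its class is an eigenvector of the self-adjoint `R(h i₀)` with the non-real eigenvalue `ĥ_{i₀}(z)`
  have hL : MemLp ((ψ - eX z : HX F E c N k μ) : (quasiSplit F E c N).automorphicQuotient → ℂ) 2 μ := hL2 z hzb hzσ hzim (ψ - eX z) (b - bX z) hT' hP' hQ'
  obtain ⟨hTv, hcomp⟩ := exists_memLp_toLp_eq_integratedOperator_of_ae_eq μ νG k (hhc i₀) (hhs i₀) (T i₀) hT (ψ - eX z) hL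
  have hμw := absolutelyContinuous_withDensity_weightX (F := F) (E := E) (c := c) (N := N) μ k
  have hwμ : (μ.withDensity fun x => (((supHeight F E c N x)⁻¹ ^ (2 * k) : ℝ≥0) : ℝ≥0∞)) ≪ μ := withDensity_absolutelyContinuous μ _
  have hae : ((T i₀ (ψ - eX z) : HX F E c N k μ) : (quasiSplit F E c N).automorphicQuotient → ℂ) =ᵐ[μ]
      (ŝ i₀ z) • ((ψ - eX z : HX F E c N k μ) : (quasiSplit F E c N).automorphicQuotient → ℂ) := by
    have h1 : ((T i₀ (ψ - eX z) : HX F E c N k μ) : (quasiSplit F E c N).automorphicQuotient → ℂ) =ᵐ[μ.withDensity fun x => (((supHeight F E c N x)⁻¹ ^ (2 * k) : ℝ≥0) : ℝ≥0∞)]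
        (((ŝ i₀ z) • (ψ - eX z) : HX F E c N k μ) : (quasiSplit F E c N).automorphicQuotient → ℂ) := by rw [hT' i₀]
    exact (h1.trans (Lp.coeFn_smul _ _)).filter_mono hμw.ae_le
  have heig : ((quasiSplit F E c N).rightRegular μ).integratedOperator ((quasiSplit F E c N).isUnitary_rightRegular μ)
        ((quasiSplit F E c N).isStronglyContinuous_rightRegular_holds μ) νG ⟨⟨h i₀, hhc i₀⟩, hhs i₀⟩ (hL.toLp _) =
      (ŝ i₀ z) • hL.toLp _ := by
    rw [← hcomp, ← MemLp.toLp_const_smul]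
    exact (MemLp.toLp_eq_toLp_iff hTv (hL.const_smul _)).2 hae
  have hzero : hL.toLp _ = 0 :=
    eq_zero_of_integratedOperator_rightRegular_eq_smul (quasiSplit F E c N) μ νG ⟨⟨h i₀, hhc i₀⟩, hhs i₀⟩ hsymm hreal hzim heig
  -- back to `X`: `ψ - eX z = 0`
  have hae0 : ((ψ - eX z : HX F E c N k μ) : (quasiSplit F E c N).automorphicQuotient → ℂ) =ᵐ[μ] 0 := by
    have h0 := MemLp.coeFn_toLp hL
    rw [hzero] at h0
    exact ((Lp.coeFn_zero ℂ 2 μ).symm.trans h0).symm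
  exact sub_eq_zero.1 (Lp.eq_zero_iff_ae_eq_zero.2 (hae0.filter_mono hwμ.ae_le))

end Generic

/-! ## §2 The head at `N = 2` (`σ₀ = 1`), `hne` discharged -/

section Two

/-- **THE `(χ, τ)` UNIQUENESS HEAD AT `N = 2`** (`σ₀ = 1`; `c² = 1`): §1 with the non-emptiness of `U₀` DISCHARGED by ★ `uniqueSetSA_nonempty_two` from `Re h_{i₀} ≥ 0` and `h_{i₀}(1) ≠ 0`
(automatic for `h = η^∨ ∗ η`).  The single remaining letter is the `L²`-letter `hL2` (§3 pays it from ★ `K2E1ChiHomogeneousL2U2.hL2_chi_cm_two`). [cite: BernsteinLapid2019, §4 Claim 2 (p. 9), Thm 2.3] -/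
theorem hunq_of_memLp_two_finDim_of_eigen {F E : Type} [Field F] [NumberField F] [Field E] [NumberField E] [Algebra F E] {c : E ≃ₐ[F] E}
    [MeasurableSpace (quasiSplit F E c 2).Adelic] [BorelSpace (quasiSplit F E c 2).Adelic]
    (μ : Measure (quasiSplit F E c 2).automorphicQuotient) [(quasiSplit F E c 2).IsAutomorphicMeasure μ]
    (νG : Measure (quasiSplit F E c 2).Adelic) [νG.IsHaarMeasure] [νG.IsInvInvariant] (k n : ℕ) {I : Type*} (i₀ : I) {h : I → (quasiSplit F E c 2).Adelic → ℂ}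
    (hhc : ∀ i, Continuous (h i)) (hhs : ∀ i, HasCompactSupport (h i)) (hsymm : ∀ g, h i₀ g⁻¹ = h i₀ g) (hreal : ∀ g, conj (h i₀ g) = h i₀ g)
    (ŝ : I → ℂ → ℂ) (hŝd : Differentiable ℂ (ŝ i₀)) (hnc : ∃ z₁ z₂ : ℂ, ŝ i₀ z₁ ≠ ŝ i₀ z₂)
    (T : I → HX F E c 2 k μ →L[ℂ] HX F E c 2 k μ)
    (hT : ∀ u : HX F E c 2 k μ, ((T i₀ u : HX F E c 2 k μ) : (quasiSplit F E c 2).automorphicQuotient → ℂ) =ᵐ[μ.withDensity fun x => (((supHeight F E c 2 x)⁻¹ ^ (2 * k) : ℝ≥0) : ℝ≥0∞)]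
      fun ξ => ∫ y, h i₀ y * (u : (quasiSplit F E c 2).automorphicQuotient → ℂ) (y⁻¹ • ξ) ∂νG)
    {V : Type*} [NormedAddCommGroup V] [NormedSpace ℂ V] (ι : HX F E c 2 k μ →L[ℂ] V) (P : V →L[ℂ] V) (α₁ : ℂ → V)
    {B : Type*} [NormedAddCommGroup B] [NormedSpace ℂ B] (L : ℂ → B →L[ℂ] V)
    {X' : Type*} [NormedAddCommGroup X'] [NormedSpace ℂ X'] (Q : HX F E c 2 k μ →L[ℂ] X') (φ₀ : ℂ) (eX : ℂ → HX F E c 2 k μ) (bX : ℂ → B)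
    (hsolT : ∀ z ∈ ball (0 : ℂ) (n + 2), 1 < z.re → ∀ i, T i (eX z) = (ŝ i z) • eX z)
    (hsolC : ∀ z ∈ ball (0 : ℂ) (n + 2), 1 < z.re → P (ι (eX z)) = φ₀ • α₁ z + L z (bX z))
    (hsolQ : ∀ z ∈ ball (0 : ℂ) (n + 2), 1 < z.re → Q (eX z) = 0)
    (hL2 : ∀ z ∈ ball (0 : ℂ) (n + 2), 1 < z.re → (ŝ i₀ z).im ≠ 0 →
      ∀ (ψ : HX F E c 2 k μ) (b' : B), (∀ i, T i ψ = (ŝ i z) • ψ) → P (ι ψ) = L z b' → Q ψ = 0 →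
        MemLp (ψ : (quasiSplit F E c 2).automorphicQuotient → ℂ) 2 μ) :
    ∃ U₀ : Set ℂ, IsOpen U₀ ∧ U₀.Nonempty ∧ U₀ ⊆ ball (0 : ℂ) (n + 2) ∩ {z : ℂ | 1 < z.re} ∧
      ∀ z ∈ U₀, ∀ (ψ : HX F E c 2 k μ) (b : B), (∀ i, T i ψ = (ŝ i z) • ψ) →
        P (ι ψ) = φ₀ • α₁ z + L z b → Q ψ = 0 → ψ = eX z := by
  refine hunq_of_memLp_of_lt_finDim_of_eigen μ νG k 1 n i₀ hhc hhs hsymm hreal ŝ hŝd.continuous ?_ T hT ι P α₁ L Q φ₀ eX bX hsolT hsolC hsolQ hL2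
  -- `Im ŝ_{i₀} ≠ 0` somewhere on the Godement part of the ball: an entire NON-CONSTANT function is not real on an open set (★ 12c §1 with `V := ℂ`)
  have hnc' : ¬ ∃ w : ℂ, ∀ z, ŝ i₀ z = w := by
    rintro ⟨w, hw⟩; obtain ⟨z₁, z₂, hne⟩ := hnc; exact hne (by rw [hw z₁, hw z₂])
  have hWo : IsOpen (ball (0 : ℂ) (n + 2) ∩ {z : ℂ | 1 < z.re}) := isOpen_ball.inter (isOpen_lt continuous_const Complex.continuous_re)
  have hWne : (ball (0 : ℂ) (n + 2) ∩ {z : ℂ | 1 < z.re}).Nonempty := by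
    refine ⟨(3 / 2 : ℂ), ?_, ?_⟩
    · rw [mem_ball, dist_zero_right]
      have h32 : ‖(3 / 2 : ℂ)‖ = 3 / 2 := by
        rw [show (3 / 2 : ℂ) = ((3 / 2 : ℝ) : ℂ) by push_cast; ring, Complex.norm_real, Real.norm_eq_abs, abs_of_pos (by norm_num)]
      rw [h32]; have : (0 : ℝ) ≤ n := Nat.cast_nonneg n; linarith
    · show (1 : ℝ) < (3 / 2 : ℂ).re
      rw [show (3 / 2 : ℂ) = ((3 / 2 : ℝ) : ℂ) by push_cast; ring, Complex.ofReal_re]; norm_num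
  obtain ⟨U₀, -, ⟨z, hz⟩, hU₀W, hsep⟩ := K2E1ChiHeckeMatrixSeparationU2.exists_isOpen_forall_not_hasEigenvalue_of_eq_smul (V := ℂ)
    (fun z => ŝ i₀ z • (1 : Module.End ℂ ℂ)) (ŝ i₀) (fun _ => rfl) hŝd hnc' hWo hWne
  refine ⟨z, hU₀W hz, fun him => hsep z hz (ŝ i₀ z).re ?_⟩
  -- if `Im ŝ(z) = 0` then `ŝ(z) = Re ŝ(z)` is a (real) eigenvalue of `ŝ(z)•1` on `ℂ`
  have hsz : ŝ i₀ z = ((ŝ i₀ z).re : ℂ) := by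
    apply Complex.ext <;> simp [him]
  refine Module.End.hasEigenvalue_of_hasEigenvector (x := (1 : ℂ)) ⟨?_, one_ne_zero⟩
  rw [Module.End.mem_eigenspace_iff, LinearMap.smul_apply, Module.End.one_apply, ← hsz]

end Two

/-! ## §3 ROW 12b's LETTER `hunq` PAID for the CM pair at `N = 2` -/

section CM

variable (L : Type) [Field L] [NumberField L] [IsCMField L]
  [MeasurableSpace (quasiSplit (↥(maximalRealSubfield L)) L (IsCMField.complexConj L) 2).Adelic]
  [BorelSpace (quasiSplit (↥(maximalRealSubfield L)) L (IsCMField.complexConj L) 2).Adelic]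

/-- **ROW 12b's `hunq` FOR THE `(χ, τ)` BALL AT THE CM PAIR, `N = 2`, ONE CALL** — the conclusion is the `hunq` letter of ★ p859726 `chiEisenstein_meromorphicOn_ball_of_letters` (`σ₀ = 1`)
byte-for-byte (`ι := iota hb`, `P := cnstN k a μZ`, constant term `φ₀ • α₁ z + Lz z b`); the proof is §2 fed with ★ `K2E1ChiHomogeneousL2U2.hL2_chi_cm_two` (item (i)); `c² = 1` holds for the
CM involution.  Letters left to the caller: `hT`∕`hδι` (★ P3-C `exists_heckePackage′`), `hK1` at `i₀` (★ `hK1_cm_two_of`), `hδL` (★ `K2E1ChiHomogeneousL2U2` §2: per column of `Lz z` from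
`α₂ j z =ᵐ zFun φ′_j · HZ^{1−z}`), `hsolT hsolC hsolQ` (★ row 11). [cite: BernsteinLapid2019, Thm 2.3 and §4 Claim 2 (p. 9)] [cite: MoeglinWaldspurger1995, IV.1.9] -/
theorem hunq_chi_cm_two_of_eigen
    (μ : Measure (quasiSplit (↥(maximalRealSubfield L)) L (IsCMField.complexConj L) 2).automorphicQuotient)
    [(quasiSplit (↥(maximalRealSubfield L)) L (IsCMField.complexConj L) 2).IsAutomorphicMeasure μ]
    (νG : Measure (quasiSplit (↥(maximalRealSubfield L)) L (IsCMField.complexConj L) 2).Adelic) [νG.IsHaarMeasure] [νG.IsInvInvariant]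
    {β : (quasiSplit (↥(maximalRealSubfield L)) L (IsCMField.complexConj L) 2).Adelic → ℝ≥0∞}
    (hβ : IsCoveringWeight ↥((arithmeticBorel (↥(maximalRealSubfield L)) L (IsCMField.complexConj L) 2).map
      (quasiSplit (↥(maximalRealSubfield L)) L (IsCMField.complexConj L) 2).arithmeticSubgroup.subtype) β)
    {μZ : Measure (borelQuotient (↥(maximalRealSubfield L)) L (IsCMField.complexConj L) 2)}
    (hμZ : ∀ f : borelQuotient (↥(maximalRealSubfield L)) L (IsCMField.complexConj L) 2 → ℝ≥0∞, Measurable f →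
      ∫⁻ z, f z ∂μZ = ∫⁻ g, β g * f (toBorelQuotient (↥(maximalRealSubfield L)) L (IsCMField.complexConj L) 2 g) ∂νG)
    (k n : ℕ) {I : Type*} (i₀ : I) {h : I → (quasiSplit (↥(maximalRealSubfield L)) L (IsCMField.complexConj L) 2).Adelic → ℂ}
    (hhc : ∀ i, Continuous (h i)) (hhs : ∀ i, HasCompactSupport (h i)) (hsymm : ∀ g, h i₀ g⁻¹ = h i₀ g) (hreal : ∀ g, conj (h i₀ g) = h i₀ g)
    (ŝ : I → ℂ → ℂ) (hŝd : Differentiable ℂ (ŝ i₀)) (hnc : ∃ z₁ z₂ : ℂ, ŝ i₀ z₁ ≠ ŝ i₀ z₂)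
    {a a₀ : ℝ≥0} (ha₀ : 0 < a₀) (haa₀ : a ≤ a₀) (hfin : μZ {z | a < borelQuotHeight (↥(maximalRealSubfield L)) L (IsCMField.complexConj L) 2 z} ≠ ∞)
    (hb : IotaBound (↥(maximalRealSubfield L)) L (IsCMField.complexConj L) 2 k a μ μZ)
    (hs : ShiftBound (↥(maximalRealSubfield L)) L (IsCMField.complexConj L) 2 k a a₀ νG μZ (h i₀))
    (T : I → HX (↥(maximalRealSubfield L)) L (IsCMField.complexConj L) 2 k μ →L[ℂ] HX (↥(maximalRealSubfield L)) L (IsCMField.complexConj L) 2 k μ)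
    (hT : ∀ u : HX (↥(maximalRealSubfield L)) L (IsCMField.complexConj L) 2 k μ,
      ((T i₀ u : HX (↥(maximalRealSubfield L)) L (IsCMField.complexConj L) 2 k μ) : (quasiSplit (↥(maximalRealSubfield L)) L (IsCMField.complexConj L) 2).automorphicQuotient → ℂ)
        =ᵐ[μ.withDensity fun x => (((supHeight (↥(maximalRealSubfield L)) L (IsCMField.complexConj L) 2 x)⁻¹ ^ (2 * k) : ℝ≥0) : ℝ≥0∞)]
      fun ξ => ∫ y, h i₀ y * (u : (quasiSplit (↥(maximalRealSubfield L)) L (IsCMField.complexConj L) 2).automorphicQuotient → ℂ) (y⁻¹ • ξ) ∂νG)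
    (hδι : deltaShift hs ∘L iota hb = restrHN (↥(maximalRealSubfield L)) L (IsCMField.complexConj L) 2 k haa₀ μZ ∘L iota hb ∘L T i₀)
    {C m : ℝ} (hC : 0 ≤ C) (hm : 0 ≤ m)
    (hK1 : ∀ f : HNcusp (↥(maximalRealSubfield L)) L (IsCMField.complexConj L) 2 k a μZ,
      ∀ᵐ x ∂(weightedTruncMeasure (↥(maximalRealSubfield L)) L (IsCMField.complexConj L) 2 k a₀ μZ),
        ‖rightConvFun (↥(maximalRealSubfield L)) L (IsCMField.complexConj L) 2 νG (h i₀)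
            ((f : HN (↥(maximalRealSubfield L)) L (IsCMField.complexConj L) 2 k a μZ) : borelQuotient (↥(maximalRealSubfield L)) L (IsCMField.complexConj L) 2 → ℂ) x‖ ≤
          C * ‖f‖ * ((borelQuotHeight (↥(maximalRealSubfield L)) L (IsCMField.complexConj L) 2 x : ℝ)) ^ (-m))
    (α₁ : ℂ → HN (↥(maximalRealSubfield L)) L (IsCMField.complexConj L) 2 k a μZ)
    {B : Type*} [NormedAddCommGroup B] [NormedSpace ℂ B] (Lz : ℂ → B →L[ℂ] HN (↥(maximalRealSubfield L)) L (IsCMField.complexConj L) 2 k a μZ)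
    (hδL : ∀ z ∈ ball (0 : ℂ) (n + 2), 1 < z.re → ∀ b' : B, ∃ M : ℝ, ∀ᵐ x ∂(weightedTruncMeasure (↥(maximalRealSubfield L)) L (IsCMField.complexConj L) 2 k a₀ μZ),
      ‖(deltaShift hs (Lz z b') : borelQuotient (↥(maximalRealSubfield L)) L (IsCMField.complexConj L) 2 → ℂ) x‖ ≤ M)
    {X' : Type*} [NormedAddCommGroup X'] [NormedSpace ℂ X'] (Q : HX (↥(maximalRealSubfield L)) L (IsCMField.complexConj L) 2 k μ →L[ℂ] X') (φ₀ : ℂ)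
    (eX : ℂ → HX (↥(maximalRealSubfield L)) L (IsCMField.complexConj L) 2 k μ) (bX : ℂ → B)
    (hsolT : ∀ z ∈ ball (0 : ℂ) (n + 2), 1 < z.re → ∀ i, T i (eX z) = (ŝ i z) • eX z)
    (hsolC : ∀ z ∈ ball (0 : ℂ) (n + 2), 1 < z.re →
      cnstN (↥(maximalRealSubfield L)) L (IsCMField.complexConj L) 2 k a μZ (iota hb (eX z)) = φ₀ • α₁ z + Lz z (bX z))
    (hsolQ : ∀ z ∈ ball (0 : ℂ) (n + 2), 1 < z.re → Q (eX z) = 0) :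
    ∃ U₀ : Set ℂ, IsOpen U₀ ∧ U₀.Nonempty ∧ U₀ ⊆ ball (0 : ℂ) (n + 2) ∩ {z : ℂ | 1 < z.re} ∧
      ∀ z ∈ U₀, ∀ (ψ : HX (↥(maximalRealSubfield L)) L (IsCMField.complexConj L) 2 k μ) (b : B),
        (∀ i, T i ψ = (ŝ i z) • ψ) →
          cnstN (↥(maximalRealSubfield L)) L (IsCMField.complexConj L) 2 k a μZ (iota hb ψ) = φ₀ • α₁ z + Lz z b → Q ψ = 0 → ψ = eX z :=
  hunq_of_memLp_two_finDim_of_eigen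
    μ νG k n i₀ hhc hhs hsymm hreal ŝ hŝd hnc T hT (iota hb) (cnstN (↥(maximalRealSubfield L)) L (IsCMField.complexConj L) 2 k a μZ) α₁ Lz Q φ₀ eX bX hsolT hsolC hsolQ
    (hL2_chi_cm_two_of_eigen L μ νG hβ hμZ k n i₀ ŝ ha₀ haa₀ hfin hb hs T hδι hC hm hK1 Lz hδL Q)

end CM

end Summit.HodgeConjecture.HodgeConjecture.Cruxes.H413.K2E1ChiUniquenessHunqCMTwoEigen
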